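import Mathlib
import HarnessLib
import Summits.ValiantsHypothesis.ValiantsHypothesis.Theorems.KPlusLogSqLawWeakLiftingTowerGraftWronskianKFourRoots

/-!
# Tower graft line — CONJECTURE W AT `K = 4`: A SIMPLE ZERO OF THE WRONSKIAN IS A TURNING POINT OF THE QUOTIENT

Helper file for LINE (B) `Cruxes/WeakLifting/Lines/tower_graft.lean` (crux `WeakLifting` = stmt-ValiantsHypothesis-19561): the second
ANALYTIC brick of the lap calculus of hand g11's memo (`evidence-g11-conjectureW-K4-levels.md` on the item).  NO stub is claimed.
For two real polynomials `F, G` and a point `x₀` with `F(x₀) ≠ 0`: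

* `deriv_div_eval_eventuallyEq` — near `x₀`, `(G/F)′ = W(F,G)/F²` (`W(F,G) = F G′ − F′ G`, Mathlib's `wronskian`);
* `deriv_div_eval_eq_zero` — so a zero of `W(F,G)` is a critical point of `G/F`;
* `deriv_deriv_div_eval` — and there `(G/F)″(x₀) = W(F,G)′(x₀) / F(x₀)²`;
* ★ `isLocalMin_div_of_wronskian`, `isLocalMax_div_of_wronskian` — a SIMPLE zero of `W(F,G)` (`W′(x₀) > 0`, resp. `< 0`) is a local
  minimum (resp. maximum) of `G/F` (Mathlib's second-derivative test);
* ★ `isLocalExtr_quotient_of_five_le` — on the orientation `d₀ + d₃ < d₁ + d₂`, at each of five positive zeros of `W(u,v)` the quotient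
  `U₂/U₁` of the distinguished members has a local extremum (by `…KFourQuotients.special_products_of_five_le`: the zero is simple and
  `U₁ ≠ 0` there; `W(U₁,U₂) = p₁₂·W(u,v)`).

HONEST FRAMING: Conjecture W at `K = 4` remains OPEN (memo §3); nothing on S4/S4f/S5/S5ᴸ, TowerB, `WeakLifting`, Conjecture B,
`MatrixDescartes` (18050), `VP ≠ VNP`.  Def-free.  Seat: prover leafhand-val-kpluslogsqlaw-1 g11, `--supports stmt-ValiantsHypothesis-19561
--as helper`.  [folklore: quotient rule, second-derivative test (Mathlib `isLocalMin_of_deriv_deriv_pos`)]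
-/

-- `Summit.ValiantsHypothesis.ValiantsHypothesis.…` repeats a component by the D-0017 layout
-- (single-conjunct summit), which the `dupNamespace` linter flags; the name is mandated.
set_option linter.dupNamespace false
set_option autoImplicit false

namespace Summit.ValiantsHypothesis.ValiantsHypothesis.Theorems.KPlusLogSqLaw.TowerGraft

open Polynomial Finset Filter Topology
open scoped BigOperators Polynomial

namespace WronskianDevelopable

/-! ## §1 The quotient rule in Wronskian form -/

/-- at a point where `F ≠ 0`: `(G/F)′(x) = W(F,G)(x) / F(x)²`. [folklore] -/
theorem deriv_div_eval (F G : ℝ[X]) {x : ℝ} (hF : F.eval x ≠ 0) :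
    deriv (fun t => G.eval t / F.eval t) x = (wronskian F G).eval x / (F.eval x) ^ 2 := by
  have h := ((G.hasDerivAt x).div (F.hasDerivAt x) hF).deriv
  refine h.trans ?_
  rw [InflectionLaw.eval_wronskian]
  ring

/-- near a point where `F ≠ 0`, `(G/F)′ = W(F,G)/F²` as functions. [folklore] -/
theorem deriv_div_eval_eventuallyEq (F G : ℝ[X]) {x₀ : ℝ} (hF : F.eval x₀ ≠ 0) :
    deriv (fun t => G.eval t / F.eval t) =ᶠ[𝓝 x₀] fun t => (wronskian F G).eval t / (F.eval t) ^ 2 := by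
  have hne : ∀ᶠ t in 𝓝 x₀, F.eval t ≠ 0 := F.continuous.continuousAt.eventually_ne hF
  filter_upwards [hne] with t ht
  exact deriv_div_eval F G ht

/-- a zero of `W(F,G)` off the zeros of `F` is a critical point of `G/F`. [folklore] -/
theorem deriv_div_eval_eq_zero (F G : ℝ[X]) {x₀ : ℝ} (hF : F.eval x₀ ≠ 0) (hW : (wronskian F G).eval x₀ = 0) :
    deriv (fun t => G.eval t / F.eval t) x₀ = 0 := by
  rw [deriv_div_eval F G hF, hW, zero_div]

/-- **second derivative at a zero of the Wronskian**: `(G/F)″(x₀) = W(F,G)′(x₀) / F(x₀)²`. [folklore] -/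
theorem deriv_deriv_div_eval (F G : ℝ[X]) {x₀ : ℝ} (hF : F.eval x₀ ≠ 0) (hW : (wronskian F G).eval x₀ = 0) :
    deriv (deriv (fun t => G.eval t / F.eval t)) x₀ = (derivative (wronskian F G)).eval x₀ / (F.eval x₀) ^ 2 := by
  rw [(deriv_div_eval_eventuallyEq F G hF).deriv_eq]
  have hF2 : (F ^ 2).eval x₀ ≠ 0 := by rw [eval_pow]; exact pow_ne_zero 2 hF
  have h := deriv_div_eval (F ^ 2) (wronskian F G) hF2
  -- rewrite the function `t ↦ W(t)/F(t)^2` as `t ↦ W(t)/(F^2)(t)`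
  have hfun : (fun t => (wronskian F G).eval t / (F.eval t) ^ 2) = fun t => (wronskian F G).eval t / (F ^ 2).eval t := by
    funext t; rw [eval_pow]
  rw [hfun, h, InflectionLaw.eval_wronskian, eval_pow, hW, mul_zero, sub_zero]
  have hF4 : (F.eval x₀ ^ 2) ^ 2 ≠ 0 := pow_ne_zero 2 (pow_ne_zero 2 hF)
  field_simp

/-- the quotient is continuous off the zeros of the denominator. [folklore] -/
theorem continuousAt_div_eval (F G : ℝ[X]) {x₀ : ℝ} (hF : F.eval x₀ ≠ 0) :
    ContinuousAt (fun t => G.eval t / F.eval t) x₀ :=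
  G.continuous.continuousAt.div F.continuous.continuousAt hF

/-! ## §2 Simple zeros of the Wronskian are turning points -/

/-- ★ **a simple zero of `W(F,G)` with `W′(x₀) > 0` (and `F(x₀) ≠ 0`) is a local MINIMUM of `G/F`.** [folklore] -/
theorem isLocalMin_div_of_wronskian (F G : ℝ[X]) {x₀ : ℝ} (hF : F.eval x₀ ≠ 0) (hW : (wronskian F G).eval x₀ = 0)
    (hW' : 0 < (derivative (wronskian F G)).eval x₀) : IsLocalMin (fun t => G.eval t / F.eval t) x₀ := by
  refine isLocalMin_of_deriv_deriv_pos ?_ (deriv_div_eval_eq_zero F G hF hW) (continuousAt_div_eval F G hF)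
  rw [deriv_deriv_div_eval F G hF hW]
  exact div_pos hW' (by positivity)

/-- ★ **a simple zero of `W(F,G)` with `W′(x₀) < 0` (and `F(x₀) ≠ 0`) is a local MAXIMUM of `G/F`.** [folklore] -/
theorem isLocalMax_div_of_wronskian (F G : ℝ[X]) {x₀ : ℝ} (hF : F.eval x₀ ≠ 0) (hW : (wronskian F G).eval x₀ = 0)
    (hW' : (derivative (wronskian F G)).eval x₀ < 0) : IsLocalMax (fun t => G.eval t / F.eval t) x₀ := by
  refine isLocalMax_of_deriv_deriv_neg ?_ (deriv_div_eval_eq_zero F G hF hW) (continuousAt_div_eval F G hF)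
  rw [deriv_deriv_div_eval F G hF hW]
  exact div_neg_of_neg_of_pos hW' (by positivity)

/-- so a zero of `W(F,G)` with `W′(x₀) ≠ 0` and `F(x₀) ≠ 0` is a local extremum of `G/F`. [folklore] -/
theorem isLocalExtr_div_of_wronskian (F G : ℝ[X]) {x₀ : ℝ} (hF : F.eval x₀ ≠ 0) (hW : (wronskian F G).eval x₀ = 0)
    (hW' : (derivative (wronskian F G)).eval x₀ ≠ 0) : IsLocalExtr (fun t => G.eval t / F.eval t) x₀ := by
  rcases lt_or_gt_of_ne hW' with h | h
  · exact (isLocalMax_div_of_wronskian F G hF hW h).isExtr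
  · exact (isLocalMin_div_of_wronskian F G hF hW h).isExtr

/-! ## §3 At a fifth zero: the quotient `U₂/U₁` turns -/

/-- ★ **on the orientation `d₀ + d₃ < d₁ + d₂`, at each of five positive zeros of `W(u,v)` the quotient `U₂/U₁` has a local
extremum** (`U₁(x) ≠ 0` and the zero is simple by `special_products_of_five_le`; `W(U₁,U₂) = p₁₂·W(u,v)`). [this work] -/
theorem isLocalExtr_quotient_of_five_le (u v : Fin 4 → ℝ) (d : Fin 4 → ℕ) (hd : StrictMono d) (hA : d 0 + d 3 < d 1 + d 2)
    (h5 : 5 ≤ ((wronskian (∑ l, C (u l) * (X : ℝ[X]) ^ d l) (∑ l, C (v l) * (X : ℝ[X]) ^ d l)).roots.toFinset.filter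
      (fun x => 0 < x)).card)
    {x : ℝ} (hx : x ∈ (wronskian (∑ l, C (u l) * (X : ℝ[X]) ^ d l) (∑ l, C (v l) * (X : ℝ[X]) ^ d l)).roots.toFinset.filter
      (fun x => 0 < x)) :
    IsLocalExtr (fun t => (∑ l, C (u l * v 2 - u 2 * v l) * (X : ℝ[X]) ^ d l).eval t /
      (∑ l, C (u l * v 1 - u 1 * v l) * (X : ℝ[X]) ^ d l).eval t) x := by
  classical
  set W : ℝ[X] := wronskian (∑ l, C (u l) * (X : ℝ[X]) ^ d l) (∑ l, C (v l) * (X : ℝ[X]) ^ d l) with hWdef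
  obtain ⟨h12neg, -, -, hder⟩ := special_products_of_five_le u v d hd hA h5 hx
  obtain ⟨c1, c2, c3, c4, c5⟩ := plucker_alternating_of_five_le u v d hd hA h5
  obtain ⟨-, -, -, h12⟩ := cell_signs u v c1 c2 c3 c4 c5
  have hW : W ≠ 0 := by
    intro h0
    have : (W.roots.toFinset.filter (fun x => 0 < x)).card = 0 := by simp [h0]
    omega
  have hx' := hx
  rw [Finset.mem_filter, Multiset.mem_toFinset] at hx'
  have hWx : W.eval x = 0 := (mem_roots hW).mp hx'.1
  -- `U₁(x) ≠ 0`
  have hU1 : (∑ l, C (u l * v 1 - u 1 * v l) * (X : ℝ[X]) ^ d l).eval x ≠ 0 := by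
    intro h0; rw [h0, zero_mul] at h12neg; exact lt_irrefl 0 h12neg
  -- `W(U₁,U₂)(x) = 0` and `W(U₁,U₂)′(x) = p₁₂ · W′(x) ≠ 0`
  have hW12 : (wronskian (∑ l, C (u l * v 1 - u 1 * v l) * (X : ℝ[X]) ^ d l)
      (∑ l, C (u l * v 2 - u 2 * v l) * (X : ℝ[X]) ^ d l)).eval x = 0 := by
    rw [wronskian_special_members, eval_mul, eval_C, ← hWdef, hWx, mul_zero]
  have hW12' : (derivative (wronskian (∑ l, C (u l * v 1 - u 1 * v l) * (X : ℝ[X]) ^ d l)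
      (∑ l, C (u l * v 2 - u 2 * v l) * (X : ℝ[X]) ^ d l))).eval x ≠ 0 := by
    rw [wronskian_special_members, derivative_mul, derivative_C, zero_mul, zero_add, eval_mul, eval_C, ← hWdef]
    rw [← hWdef] at hder
    exact mul_ne_zero h12 hder
  exact isLocalExtr_div_of_wronskian _ _ hU1 hW12 hW12'

end WronskianDevelopable

end Summit.ValiantsHypothesis.ValiantsHypothesis.Theorems.KPlusLogSqLaw.TowerGraft
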